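import Literature.Barriers.MatrixMultiplication.UnstableTensorBarrier
import Literature.Computability.AlgebraicComplexity.QuantumFunctionalsRestrictionProofs
import Literature.Computability.AlgebraicComplexity.QuantumFunctionalsFree
import Literature.NumberTheory.Automorphic.IwasawaDecompositionArchimedean
import Mathlib.Analysis.Matrix.Spectrum
import Mathlib.Analysis.Matrix.PosDef
import Mathlib.Topology.Sequences
import HarnessLib

/-!
# Unstable tensors carry a separating weight (Hilbert–Mumford for `SL × SL × SL`, torus form)

Topic `Literature/Barriers/MatrixMultiplication`; part of the PROOF of the catalogue entry
`UnstableTensorBarrier` (`UnstableTensorBarrier.lean`: Bläser–Lysikov 2020, Thm. 16 ∧ Thm. 17).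
Everything here is PROVED.

Bläser–Lysikov (§2.3) recall the Hilbert–Mumford criterion: `t` is unstable iff some one-parameter
subgroup of `SL(V₁) × SL(V₂) × SL(V₃)` drives `t` to `0`, which "can be used to give a more
combinatorial definition of instability" ([8] = BCCGNSU 2017, §4): after a change of bases the
support of `t` lies strictly on one side of a hyperplane through the barycentre. We prove exactly
the consequence needed downstream (`UnstableTensorBarrierSliceRankBound.lean`), by the compactness
argument behind the criterion and without algebraic groups:

* `IsUnstable.exists_sepWeight` — if `0 ∈ cl(SL³·t)` then there is a tensor `s`, restriction-
  equivalent to `t` (`s = (U₁ᴴ ⊗ U₂ᴴ ⊗ U₃ᴴ)·t` with `Uⱼ` unitary), and real weights `x, y, z` on the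
  three index sets, each of total sum `0`, with `x a + y b + z c ≥ 1` whenever `s a b c ≠ 0`.

Proof. For `g ∈ SL_n(ℂ)` write `gᴴg = U diag(d) Uᴴ` (spectral theorem; `d > 0`, `∏ d = det gᴴg = 1`,
`exists_unitary_diag_of_det_eq_one`). Since `‖(N₁ ⊗ N₂ ⊗ N₃)·t‖²` depends on the `Nⱼ` only through
`NⱼᴴNⱼ` (the tree's `tensorNormSq_actTensor_eq_of_gram_eq`) and `diag(√d)Uᴴ` has the same Gram
matrix as `g`, `‖g·t‖² = ∑ d₁(a)d₂(b)d₃(c) |(Uᴴ·t)_{abc}|²` (`tensorNormSq_actTensor_of_gram_diag`).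
Take `g_m` with `g_m·t → 0`; by compactness of the unitary groups (the tree's
`Matrix.isCompact_unitaryGroup`) pass to a subsequence with `U_m → V`; on the support of `Vᴴ·t` the
products `d_{m}(abc)` tend to `0`, so one `m` has them all `≤ e⁻¹`, and `x = -log d₁`, `y = -log d₂`,
`z = -log d₃` (for that `m`) is the separating weight.

## References

* M. Bläser, V. Lysikov, MFCS 2020, LIPIcs 170, 17, Def. 2 and §2.3 (Hilbert–Mumford criterion).
  [BlaserLysikov2020]
* J. Blasiak, T. Church, H. Cohn, J. Grochow, E. Naslund, W. Sawin, C. Umans, Discrete Analysis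
  2017:3, §4 (instability and slice rank). [BlasiakChurchCohnGrochowNaslundSawinUmans2017]
-/

noncomputable section

open scoped BigOperators Matrix ComplexOrder
open _root_.Filter _root_.Topology

namespace Literature.Barriers.MatrixMultiplication

open Literature.Computability.AlgebraicComplexity

universe u

/-! ## `gᴴ g = U diag(d) Uᴴ` with `d > 0`, `∏ d = 1` for `det g = 1` -/

section Spectral

variable {n : Type*} [Fintype n] [DecidableEq n]

/-- For a complex matrix `g` of determinant `1`, the positive matrix `gᴴg` is `U diag(d) Uᴴ` with
`U` unitary and real `d > 0` of product `1` (spectral theorem; `∏ d = det(gᴴg) = 1`). [folklore] -/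
theorem exists_unitary_diag_of_det_eq_one (g : Matrix n n ℂ) (hg : g.det = 1) :
    ∃ (U : Matrix n n ℂ) (d : n → ℝ), U ∈ Matrix.unitaryGroup n ℂ ∧ (∀ i, 0 < d i) ∧
      ∏ i, d i = 1 ∧ gᴴ * g = U * Matrix.diagonal (fun i => (d i : ℂ)) * star U := by
  have hP : (gᴴ * g).PosSemidef := Matrix.posSemidef_conjTranspose_mul_self g
  have hdec : gᴴ * g = (hP.1.eigenvectorUnitary : Matrix n n ℂ) *
      Matrix.diagonal (fun i => (hP.1.eigenvalues i : ℂ)) *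
        star (hP.1.eigenvectorUnitary : Matrix n n ℂ) := by
    conv_lhs => rw [hP.1.spectral_theorem, Unitary.conjStarAlgAut_apply]
    rfl
  have hdet : (gᴴ * g).det = 1 := by
    rw [Matrix.det_mul, Matrix.det_conjTranspose, hg, star_one, one_mul]
  have hprod : (RCLike.ofReal (∏ i, hP.1.eigenvalues i) : ℂ) = 1 := by
    rw [RCLike.ofReal_prod, ← hP.1.det_eq_prod_eigenvalues, hdet]
  have hprod' : ∏ i, hP.1.eigenvalues i = 1 :=
    RCLike.ofReal_injective (K := ℂ) (hprod.trans RCLike.ofReal_one.symm)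
  have hpos : ∀ i, 0 < hP.1.eigenvalues i := fun i =>
    (hP.eigenvalues_nonneg i).lt_of_ne fun h0 => by
      have : ∏ i, hP.1.eigenvalues i = 0 := Finset.prod_eq_zero (Finset.mem_univ i) h0.symm
      rw [hprod'] at this
      exact one_ne_zero this
  exact ⟨(hP.1.eigenvectorUnitary : Matrix n n ℂ), hP.1.eigenvalues, SetLike.coe_mem _, hpos, hprod',
    hdec⟩

/-- `(diag(√d) Uᴴ)ᴴ (diag(√d) Uᴴ) = U diag(d) Uᴴ` for real `d ≥ 0`. [folklore] -/
theorem conjTranspose_sqrtDiag_mul (U : Matrix n n ℂ) (d : n → ℝ) (hd : ∀ i, 0 ≤ d i) :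
    (Matrix.diagonal (fun i => ((Real.sqrt (d i) : ℝ) : ℂ)) * star U)ᴴ *
        (Matrix.diagonal (fun i => ((Real.sqrt (d i) : ℝ) : ℂ)) * star U) =
      U * Matrix.diagonal (fun i => (d i : ℂ)) * star U := by
  have hdd : (fun i => ((Real.sqrt (d i) : ℝ) : ℂ) * ((Real.sqrt (d i) : ℝ) : ℂ)) =
      fun i => (d i : ℂ) := funext fun i => by
    rw [← Complex.ofReal_mul, Real.mul_self_sqrt (hd i)]
  have hdstar : star (fun i => ((Real.sqrt (d i) : ℝ) : ℂ)) =
      fun i => ((Real.sqrt (d i) : ℝ) : ℂ) := funext fun i => by simp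
  rw [Matrix.conjTranspose_mul, Matrix.diagonal_conjTranspose, hdstar,
    ← Matrix.star_eq_conjTranspose, star_star, Matrix.mul_assoc,
    ← Matrix.mul_assoc (Matrix.diagonal _), Matrix.diagonal_mul_diagonal, ← Matrix.mul_assoc, hdd]

end Spectral

/-! ## `‖g·t‖² = ∑ d₁(a) d₂(b) d₃(c) |(Uᴴ·t)_{abc}|²` -/

section Norm

variable {ι κ μ : Type*} [Fintype ι] [Fintype κ] [Fintype μ] [DecidableEq ι] [DecidableEq κ]
  [DecidableEq μ]

/-- A torus scaling by real `√d` multiplies `|entry|²` by `d₁(a) d₂(b) d₃(c)`. [folklore] -/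
theorem tensorNormSq_actTensor_sqrtDiag (d₁ : ι → ℝ) (d₂ : κ → ℝ) (d₃ : μ → ℝ)
    (hd₁ : ∀ a, 0 ≤ d₁ a) (hd₂ : ∀ b, 0 ≤ d₂ b) (hd₃ : ∀ c, 0 ≤ d₃ c) (s : ι → κ → μ → ℂ) :
    tensorNormSq (actTensor (Matrix.diagonal fun a => ((Real.sqrt (d₁ a) : ℝ) : ℂ))
        (Matrix.diagonal fun b => ((Real.sqrt (d₂ b) : ℝ) : ℂ))
        (Matrix.diagonal fun c => ((Real.sqrt (d₃ c) : ℝ) : ℂ)) s) =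
      ∑ a, ∑ b, ∑ c, d₁ a * d₂ b * d₃ c * ‖s a b c‖ ^ 2 := by
  unfold tensorNormSq
  refine Finset.sum_congr rfl fun a _ => Finset.sum_congr rfl fun b _ =>
    Finset.sum_congr rfl fun c _ => ?_
  rw [actTensor_diagonal_apply, norm_mul, norm_mul, norm_mul, Complex.norm_real, Complex.norm_real,
    Complex.norm_real, Real.norm_of_nonneg (Real.sqrt_nonneg _),
    Real.norm_of_nonneg (Real.sqrt_nonneg _), Real.norm_of_nonneg (Real.sqrt_nonneg _), mul_pow,
    mul_pow, mul_pow, Real.sq_sqrt (hd₁ a), Real.sq_sqrt (hd₂ b), Real.sq_sqrt (hd₃ c)]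

/-- **`‖(g₁ ⊗ g₂ ⊗ g₃)·t‖² = ∑ d₁(a) d₂(b) d₃(c) |((U₁ᴴ ⊗ U₂ᴴ ⊗ U₃ᴴ)·t)_{abc}|²`** whenever
`gⱼᴴgⱼ = Uⱼ diag(dⱼ) Uⱼᴴ` with real `dⱼ ≥ 0`: the norm depends on `gⱼ` only through `gⱼᴴgⱼ`
(CVZ Rem. 3.17, the tree's `tensorNormSq_actTensor_eq_of_gram_eq`), which is shared by
`diag(√dⱼ) Uⱼᴴ`. [folklore] -/
theorem tensorNormSq_actTensor_of_gram_diag {g₁ U₁ : Matrix ι ι ℂ} {g₂ U₂ : Matrix κ κ ℂ}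
    {g₃ U₃ : Matrix μ μ ℂ} {d₁ : ι → ℝ} {d₂ : κ → ℝ} {d₃ : μ → ℝ} (hd₁ : ∀ a, 0 ≤ d₁ a)
    (hd₂ : ∀ b, 0 ≤ d₂ b) (hd₃ : ∀ c, 0 ≤ d₃ c)
    (h₁ : g₁ᴴ * g₁ = U₁ * Matrix.diagonal (fun a => (d₁ a : ℂ)) * star U₁)
    (h₂ : g₂ᴴ * g₂ = U₂ * Matrix.diagonal (fun b => (d₂ b : ℂ)) * star U₂)
    (h₃ : g₃ᴴ * g₃ = U₃ * Matrix.diagonal (fun c => (d₃ c : ℂ)) * star U₃) (t : ι → κ → μ → ℂ) :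
    tensorNormSq (actTensor g₁ g₂ g₃ t) =
      ∑ a, ∑ b, ∑ c, d₁ a * d₂ b * d₃ c * ‖actTensor (star U₁) (star U₂) (star U₃) t a b c‖ ^ 2 := by
  have e₁ := conjTranspose_sqrtDiag_mul U₁ d₁ hd₁
  have e₂ := conjTranspose_sqrtDiag_mul U₂ d₂ hd₂
  have e₃ := conjTranspose_sqrtDiag_mul U₃ d₃ hd₃
  rw [← h₁] at e₁
  rw [← h₂] at e₂
  rw [← h₃] at e₃
  rw [tensorNormSq_actTensor_eq_of_gram_eq t e₁.symm e₂.symm e₃.symm, ← actTensor_actTensor,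
    tensorNormSq_actTensor_sqrtDiag d₁ d₂ d₃ hd₁ hd₂ hd₃]

end Norm

section Continuity

variable {ι κ μ ι' κ' μ' : Type*} [Fintype ι] [Fintype κ] [Fintype μ]

/-- The action is continuous in the three matrices (polynomial entries). [folklore] -/
theorem _root_.Continuous.actTensor_args {X : Type*} [TopologicalSpace X] {A : X → Matrix ι' ι ℂ}
    {B : X → Matrix κ' κ ℂ} {C : X → Matrix μ' μ ℂ} (hA : Continuous A) (hB : Continuous B)
    (hC : Continuous C) (t : ι → κ → μ → ℂ) :
    Continuous fun x => actTensor (A x) (B x) (C x) t := by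
  refine continuous_pi fun a => continuous_pi fun b => continuous_pi fun c => ?_
  simp only [actTensor_apply]
  refine continuous_finsetSum _ fun a' _ => continuous_finsetSum _ fun b' _ =>
    continuous_finsetSum _ fun c' _ => ?_
  exact (((hA.matrix_elem a a').mul (hB.matrix_elem b b')).mul (hC.matrix_elem c c')).mul
    continuous_const

end Continuity

/-! ## The separating weight of an unstable tensor -/

section Main

variable {ι κ μ : Type} [Fintype ι] [Fintype κ] [Fintype μ] [DecidableEq ι] [DecidableEq κ]
  [DecidableEq μ]

/-- **Unstable tensors carry a separating weight** (the torus form of the Hilbert–Mumford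
criterion, BL §2.3 / BCCGNSU §4, in the generality needed): if `0 ∈ cl(SL(ℂ^ι) × SL(ℂ^κ) × SL(ℂ^μ) · t)`
then some tensor `s` restriction-equivalent to `t` (a unitary change of bases of `t`) admits real
weights `x, y, z`, each summing to `0`, with `x a + y b + z c ≥ 1` on the support of `s`.
[cite: BlaserLysikov2020, §2.3] -/
theorem IsUnstable.exists_sepWeight {t : ι → κ → μ → ℂ} (ht : IsUnstable t) :
    ∃ s : ι → κ → μ → ℂ, TensorRestrictsTo s t ∧ TensorRestrictsTo t s ∧
      ∃ (x : ι → ℝ) (y : κ → ℝ) (z : μ → ℝ), ∑ a, x a = 0 ∧ ∑ b, y b = 0 ∧ ∑ c, z c = 0 ∧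
        ∀ a b c, s a b c ≠ 0 → 1 ≤ x a + y b + z c := by
  -- (i) a sequence `g m ∈ SL³` with `g m · t → 0`
  obtain ⟨u, hu, hu0⟩ := mem_closure_iff_seq_limit.1 ht
  choose g hg using hu
  obtain ⟨T, hTdef⟩ : ∃ T : ℕ → (ι → κ → μ → ℂ), ∀ m, T m =
      actTensor ((g m).1 : Matrix ι ι ℂ) ((g m).2.1 : Matrix κ κ ℂ) ((g m).2.2 : Matrix μ μ ℂ) t :=
    ⟨_, fun m => rfl⟩
  have hTu : T = u := funext fun m => (hTdef m).trans (hg m)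
  have hT0 : Tendsto (fun m => tensorNormSq (T m)) atTop (𝓝 0) := by
    have hu0' : Tendsto T atTop (𝓝 0) := by rw [hTu]; exact hu0
    have h := (continuous_tensorNormSq.tendsto (0 : ι → κ → μ → ℂ)).comp hu0'
    have h0 : tensorNormSq (0 : ι → κ → μ → ℂ) = 0 := (tensorNormSq_eq_zero_iff _).2 rfl
    rwa [h0] at h
  -- (ii) spectral data of `(g m)ⱼᴴ (g m)ⱼ`
  choose U₁ d₁ hU₁ hd₁ hp₁ he₁ using fun m =>
    exists_unitary_diag_of_det_eq_one ((g m).1 : Matrix ι ι ℂ) (g m).1.prop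
  choose U₂ d₂ hU₂ hd₂ hp₂ he₂ using fun m =>
    exists_unitary_diag_of_det_eq_one ((g m).2.1 : Matrix κ κ ℂ) (g m).2.1.prop
  choose U₃ d₃ hU₃ hd₃ hp₃ he₃ using fun m =>
    exists_unitary_diag_of_det_eq_one ((g m).2.2 : Matrix μ μ ℂ) (g m).2.2.prop
  have hnorm : ∀ m, tensorNormSq (T m) = ∑ a, ∑ b, ∑ c, d₁ m a * d₂ m b * d₃ m c *
      ‖actTensor (star (U₁ m)) (star (U₂ m)) (star (U₃ m)) t a b c‖ ^ 2 := fun m => by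
    rw [hTdef m]
    exact tensorNormSq_actTensor_of_gram_diag (fun a => (hd₁ m a).le) (fun b => (hd₂ m b).le)
      (fun c => (hd₃ m c).le) (he₁ m) (he₂ m) (he₃ m) t
  -- (iii) a convergent subsequence of the unitaries
  set K : Set (Matrix ι ι ℂ × Matrix κ κ ℂ × Matrix μ μ ℂ) :=
    (Matrix.unitaryGroup ι ℂ : Set (Matrix ι ι ℂ)) ×ˢ
      ((Matrix.unitaryGroup κ ℂ : Set (Matrix κ κ ℂ)) ×ˢ (Matrix.unitaryGroup μ ℂ : Set (Matrix μ μ ℂ)))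
    with hK
  have hKc : IsCompact K :=
    Literature.NumberTheory.Automorphic.Matrix.isCompact_unitaryGroup.prod
      (Literature.NumberTheory.Automorphic.Matrix.isCompact_unitaryGroup.prod
        Literature.NumberTheory.Automorphic.Matrix.isCompact_unitaryGroup)
  have hmem : ∀ m, (U₁ m, U₂ m, U₃ m) ∈ K := fun m =>
    Set.mk_mem_prod (hU₁ m) (Set.mk_mem_prod (hU₂ m) (hU₃ m))
  haveI : FirstCountableTopology (Matrix ι ι ℂ) :=
    inferInstanceAs (FirstCountableTopology (ι → ι → ℂ))
  haveI : FirstCountableTopology (Matrix κ κ ℂ) :=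
    inferInstanceAs (FirstCountableTopology (κ → κ → ℂ))
  haveI : FirstCountableTopology (Matrix μ μ ℂ) :=
    inferInstanceAs (FirstCountableTopology (μ → μ → ℂ))
  obtain ⟨V, hVK, φ, hφ, hV⟩ := hKc.tendsto_subseq hmem
  obtain ⟨hV₁, hV₂, hV₃⟩ : V.1 ∈ Matrix.unitaryGroup ι ℂ ∧ V.2.1 ∈ Matrix.unitaryGroup κ ℂ ∧
      V.2.2 ∈ Matrix.unitaryGroup μ ℂ := ⟨hVK.1, hVK.2.1, hVK.2.2⟩
  -- (iv) the limit change of bases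
  obtain ⟨s, hs⟩ : ∃ s : ι → κ → μ → ℂ, s = actTensor (star V.1) (star V.2.1) (star V.2.2) t :=
    ⟨_, rfl⟩
  obtain ⟨sq, hsq⟩ : ∃ sq : ℕ → (ι → κ → μ → ℂ), ∀ m, sq m =
      actTensor (star (U₁ (φ m))) (star (U₂ (φ m))) (star (U₃ (φ m))) t := ⟨_, fun m => rfl⟩
  have hsq_tendsto : Tendsto sq atTop (𝓝 s) := by
    have hc : Continuous fun p : Matrix ι ι ℂ × Matrix κ κ ℂ × Matrix μ μ ℂ =>
        actTensor (star p.1) (star p.2.1) (star p.2.2) t :=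
      continuous_fst.star.actTensor_args (continuous_fst.comp continuous_snd).star
        (continuous_snd.comp continuous_snd).star t
    have hsq' : sq = (fun p : Matrix ι ι ℂ × Matrix κ κ ℂ × Matrix μ μ ℂ =>
        actTensor (star p.1) (star p.2.1) (star p.2.2) t) ∘ ((fun m => (U₁ m, U₂ m, U₃ m)) ∘ φ) :=
      funext fun m => hsq m
    rw [hsq', hs]
    exact (hc.tendsto V).comp hV
  refine ⟨s, ?_, hs ▸ tensorRestrictsTo_actTensor _ _ _ t, ?_⟩
  · -- `s ≥ t`: `t = (V₁ ⊗ V₂ ⊗ V₃)·s`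
    have hts : t = actTensor V.1 V.2.1 V.2.2 s := by
      rw [hs, actTensor_actTensor, Matrix.mem_unitaryGroup_iff.1 hV₁,
        Matrix.mem_unitaryGroup_iff.1 hV₂, Matrix.mem_unitaryGroup_iff.1 hV₃, actTensor_one]
    rw [hts]
    exact tensorRestrictsTo_actTensor _ _ _ s
  -- (v) on the support of `s`, the eigenvalue products along the subsequence become `≤ e⁻¹`
  have hev : ∀ p : ι × κ × μ, ∀ᶠ m in atTop, s p.1 p.2.1 p.2.2 ≠ 0 →
      d₁ (φ m) p.1 * d₂ (φ m) p.2.1 * d₃ (φ m) p.2.2 ≤ Real.exp (-1) := by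
    rintro ⟨a, b, c⟩
    by_cases hp : s a b c = 0
    · exact Eventually.of_forall fun m h => absurd hp h
    · -- `D_m ‖sq m abc‖² ≤ ‖T (φ m)‖² → 0` and `‖sq m abc‖² → ‖s abc‖² > 0`
      have hpos : 0 < ‖s a b c‖ ^ 2 := by positivity
      have h1 : Tendsto (fun m => ‖sq m a b c‖ ^ 2) atTop (𝓝 (‖s a b c‖ ^ 2)) := by
        have hev' : Continuous fun w : ι → κ → μ → ℂ => w a b c := by fun_prop
        exact (((hev'.tendsto s).comp hsq_tendsto).norm).pow 2
      have h2 : Tendsto (fun m => tensorNormSq (T (φ m))) atTop (𝓝 0) :=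
        hT0.comp hφ.tendsto_atTop
      have h3 : Tendsto (fun m => tensorNormSq (T (φ m)) / ‖sq m a b c‖ ^ 2) atTop (𝓝 0) := by
        have := h2.div h1 hpos.ne'
        rwa [zero_div] at this
      have h4 : ∀ᶠ m in atTop, tensorNormSq (T (φ m)) / ‖sq m a b c‖ ^ 2 < Real.exp (-1) :=
        h3 (Iio_mem_nhds (Real.exp_pos _))
      have h5 : ∀ᶠ m in atTop, ‖s a b c‖ ^ 2 / 2 < ‖sq m a b c‖ ^ 2 :=
        h1 (Ioi_mem_nhds (by linarith))
      filter_upwards [h4, h5] with m hm4 hm5 _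
      have hqpos : 0 < ‖sq m a b c‖ ^ 2 := by linarith [hpos]
      have hle : d₁ (φ m) a * d₂ (φ m) b * d₃ (φ m) c * ‖sq m a b c‖ ^ 2 ≤
          tensorNormSq (T (φ m)) := by
        rw [hnorm (φ m), hsq m]
        have hterm : ∀ a' b' c', 0 ≤ d₁ (φ m) a' * d₂ (φ m) b' * d₃ (φ m) c' *
            ‖actTensor (star (U₁ (φ m))) (star (U₂ (φ m))) (star (U₃ (φ m))) t a' b' c'‖ ^ 2 :=
          fun a' b' c' => by
            have := hd₁ (φ m) a'; have := hd₂ (φ m) b'; have := hd₃ (φ m) c'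
            positivity
        calc d₁ (φ m) a * d₂ (φ m) b * d₃ (φ m) c *
              ‖actTensor (star (U₁ (φ m))) (star (U₂ (φ m))) (star (U₃ (φ m))) t a b c‖ ^ 2
            ≤ ∑ c', d₁ (φ m) a * d₂ (φ m) b * d₃ (φ m) c' *
                ‖actTensor (star (U₁ (φ m))) (star (U₂ (φ m))) (star (U₃ (φ m))) t a b c'‖ ^ 2 :=
              Finset.single_le_sum (f := fun c' => d₁ (φ m) a * d₂ (φ m) b * d₃ (φ m) c' *
                ‖actTensor (star (U₁ (φ m))) (star (U₂ (φ m))) (star (U₃ (φ m))) t a b c'‖ ^ 2)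
                (fun c' _ => hterm a b c') (Finset.mem_univ c)
          _ ≤ ∑ b', ∑ c', d₁ (φ m) a * d₂ (φ m) b' * d₃ (φ m) c' *
                ‖actTensor (star (U₁ (φ m))) (star (U₂ (φ m))) (star (U₃ (φ m))) t a b' c'‖ ^ 2 :=
              Finset.single_le_sum (f := fun b' => ∑ c', d₁ (φ m) a * d₂ (φ m) b' * d₃ (φ m) c' *
                ‖actTensor (star (U₁ (φ m))) (star (U₂ (φ m))) (star (U₃ (φ m))) t a b' c'‖ ^ 2)
                (fun b' _ => Finset.sum_nonneg fun c' _ => hterm a b' c') (Finset.mem_univ b)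
          _ ≤ ∑ a', ∑ b', ∑ c', d₁ (φ m) a' * d₂ (φ m) b' * d₃ (φ m) c' *
                ‖actTensor (star (U₁ (φ m))) (star (U₂ (φ m))) (star (U₃ (φ m))) t a' b' c'‖ ^ 2 :=
              Finset.single_le_sum (f := fun a' => ∑ b', ∑ c', d₁ (φ m) a' * d₂ (φ m) b' *
                d₃ (φ m) c' *
                ‖actTensor (star (U₁ (φ m))) (star (U₂ (φ m))) (star (U₃ (φ m))) t a' b' c'‖ ^ 2)
                (fun a' _ => Finset.sum_nonneg fun b' _ => Finset.sum_nonneg fun c' _ =>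
                  hterm a' b' c') (Finset.mem_univ a)
      have hdiv : d₁ (φ m) a * d₂ (φ m) b * d₃ (φ m) c ≤
          tensorNormSq (T (φ m)) / ‖sq m a b c‖ ^ 2 := by
        rw [le_div_iff₀ hqpos]
        exact hle
      exact hdiv.trans hm4.le
  obtain ⟨m, hm⟩ := (eventually_all.2 hev).exists
  -- (vi) the weights `-log dⱼ (φ m)`
  refine ⟨fun a => -Real.log (d₁ (φ m) a), fun b => -Real.log (d₂ (φ m) b),
    fun c => -Real.log (d₃ (φ m) c), ?_, ?_, ?_, fun a b c habc => ?_⟩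
  · rw [Finset.sum_neg_distrib, ← Real.log_prod (fun a _ => (hd₁ (φ m) a).ne'), hp₁, Real.log_one,
      neg_zero]
  · rw [Finset.sum_neg_distrib, ← Real.log_prod (fun b _ => (hd₂ (φ m) b).ne'), hp₂, Real.log_one,
      neg_zero]
  · rw [Finset.sum_neg_distrib, ← Real.log_prod (fun c _ => (hd₃ (φ m) c).ne'), hp₃, Real.log_one,
      neg_zero]
  · have hD := hm (a, b, c) habc
    have hDpos : 0 < d₁ (φ m) a * d₂ (φ m) b * d₃ (φ m) c :=
      mul_pos (mul_pos (hd₁ (φ m) a) (hd₂ (φ m) b)) (hd₃ (φ m) c)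
    have hlog : Real.log (d₁ (φ m) a * d₂ (φ m) b * d₃ (φ m) c) ≤ -1 :=
      (Real.log_le_iff_le_exp hDpos).2 hD
    rw [Real.log_mul (mul_pos (hd₁ (φ m) a) (hd₂ (φ m) b)).ne' (hd₃ (φ m) c).ne',
      Real.log_mul (hd₁ (φ m) a).ne' (hd₂ (φ m) b).ne'] at hlog
    linarith

end Main

end Literature.Barriers.MatrixMultiplication

end
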